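import Summits.CriticalPhenomena.PercolationContinuityZ3.Theorems.FK.EdgeDensityDerivative
import Summits.CriticalPhenomena.PercolationContinuityZ3.Theorems.FK.InfiniteVolumeDefs
import Mathlib.Analysis.SpecialFunctions.Log.Deriv
import HarnessLib

/-!
# FK-continuity cell, FO-10a: the `p`-derivative of the finite-volume random-cluster partition function —
# `d/dp log Z^B_G(p,q) = (E^B_{G,p,q}|ω| − p |E(G)|) / (p(1−p))` (Grimmett 2006, Thm. (3.73)(a), first coordinate of (4.72)–(4.73))

Registered R110 (cell INBOX l.7501, 2026-08-25); registry row FO-10a-g341p; label PDV-A (coordinator fk-4 g227).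
Cell `fk-continuity` (bschramm), row FO-10a (pressure layer); support file for the FK-continuity transplant
(`--supports stmt-CriticalPhenomena-4575`); builds on p205010 (kernel theorem, internal audit signed; external expert
review pending). Pure proofs; no definitions, no named facts, no sorries; any finite graph.
UNCONDITIONAL finite-volume structure; it decides nothing about FH / TP_FK / the value of `p_c(q)`.

Grimmett's (4.72)–(4.73): `dG^ξ_Λ/dπ = |E_Λ|⁻¹ φ^ξ_{Λ,p,q}(|η ∩ E_Λ|)` in the variable `π = log(p/(1−p))`; in the variable `p`
(`dπ/dp = 1/(p(1−p))`, and `G = |E_Λ|⁻¹ log Y` differs from `|E_Λ|⁻¹ log Z` by the explicit `log(1−p)`, Grimmett (4.70)) this reads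
`d/dp log Z^ξ_Λ(p,q) = (φ^ξ_{Λ,p,q}(|η|) − p|E_Λ|)/(p(1−p))`. The tree's `EdgeDensityDerivative.lean` differentiates the
EXPECTATIONS `E^B_{G,p,q}[X]` in `p` (Thm. (2.43)); this file records the derivative of the LOG-PARTITION FUNCTION for the
finite-volume measure `rcMeasure G p q B` with one wired class `B` (companion of `PartitionFunctionQDerivative.lean`):

* `hasDerivAt_rcPartitionFunction_p` — `d/dp Z^B_G(p,q) = Z^B_G(p,q) · (E^B_{G,p,q}|ω| − p|E(G)|)/(p(1−p))` (`0 < p < 1`, `q > 0`);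
* **`hasDerivAt_log_rcPartitionFunction_p`** — `d/dp log Z^B_G(p,q) = (E^B_{G,p,q}|ω| − p|E(G)|)/(p(1−p))`;
* `hasDerivAt_log_rcPartitionFunction_box_div_p`, `deriv_log_rcPartitionFunction_box_div_p` — the per-site box form
  `d/dp (|Λ_N|⁻¹ log Z^B_{Λ_N}(p,q)) = (|Λ_N|⁻¹ E^B_{Λ_N,p,q}|ω| − p |E_{Λ_N}|/|Λ_N|)/(p(1−p))` (any wired class `B` of `Λ_N`).

## References

* G. Grimmett, *The Random-Cluster Model*, Springer 2006 (`book:grimmett2006-random-cluster-model`): Thm. (2.43)–(2.47)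
  p. 40; Thm. (3.73)(a) p. 57; §4.5 (4.70)–(4.73) [PDF p. 92]. [Grimmett2006]
-/

noncomputable section

open Finset Filter Topology

namespace Summit.CriticalPhenomena.PercolationContinuityZ3.Theorems.FK

open Literature.Probability.Percolation Literature.Probability.LatticeModels

/-! ### Any finite graph -/

section Finite

variable {V : Type*} [Fintype V] [DecidableEq V] (G : SimpleGraph V) [DecidableRel G.Adj]

/-- **`d/dp Z^B_G(p,q) = Z^B_G(p,q) · (E^B_{G,p,q}|ω| − p|E(G)|)/(p(1−p))`** (`0 < p < 1`, `q > 0`): each weight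
`p^{|ω|}(1−p)^{|E∖ω|}q^{k^B(ω)}` has logarithmic derivative `|ω|/p − |E∖ω|/(1−p) = (|ω| − p|E|)/(p(1−p))`.
[cite: Grimmett2006, Thm. (2.43) eq. (2.46)–(2.47); Thm. (3.73)(a)] -/
theorem hasDerivAt_rcPartitionFunction_p {p q : ℝ} (hp : p ∈ Set.Ioo (0 : ℝ) 1) (hq : 0 < q) (B : Set V) :
    HasDerivAt (fun r => rcPartitionFunction G r q B)
      (rcPartitionFunction G p q B *
        ((rcExpect G p q B (fun ω => (#ω : ℝ)) - p * #G.edgeFinset) / (p * (1 - p)))) p := by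
  have hp0 : p ≠ 0 := hp.1.ne'
  have hp1 : (1 : ℝ) - p ≠ 0 := (sub_pos.2 hp.2).ne'
  have hpI : p ∈ Set.Icc (0 : ℝ) 1 := ⟨hp.1.le, hp.2.le⟩
  have hZ := (rcPartitionFunction_pos G hpI hq B).ne'
  have h : HasDerivAt (fun r => rcPartitionFunction G r q B)
      (∑ ω ∈ G.edgeFinset.powerset, rcWeight G p q B ω *
        ((#ω : ℝ) / p - (#(G.edgeFinset \ ω) : ℝ) / (1 - p))) p := by
    unfold rcPartitionFunction rcWeight
    exact HasDerivAt.fun_sum fun ω _ =>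
      hasDerivAt_pow_mul_one_sub_pow_mul #ω #(G.edgeFinset \ ω) _ hp0 hp.2.ne
  refine h.congr_deriv ?_
  -- `|ω|/p − |E∖ω|/(1−p) = (|ω| − p|E|)/(p(1−p))` on edge sets, then collect `Z · E[·]`
  have hℓ : ∀ ω ∈ G.edgeFinset.powerset,
      rcWeight G p q B ω * ((#ω : ℝ) / p - (#(G.edgeFinset \ ω) : ℝ) / (1 - p)) =
        rcWeight G p q B ω * (((#ω : ℝ) - p * #G.edgeFinset) / (p * (1 - p))) := by
    intro ω hω
    rw [Finset.card_sdiff_of_subset (Finset.mem_powerset.1 hω),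
      Nat.cast_sub (Finset.card_le_card (Finset.mem_powerset.1 hω))]
    congr 1
    field_simp
    ring
  have hE : rcExpect G p q B (fun ω => (#ω : ℝ)) =
      (∑ ω ∈ G.edgeFinset.powerset, rcWeight G p q B ω * (#ω : ℝ)) / rcPartitionFunction G p q B := by
    rw [rcExpect, Finset.sum_div]
    refine Finset.sum_congr rfl fun ω _ => ?_
    rw [div_mul_eq_mul_div]
  have hZdef : rcPartitionFunction G p q B = ∑ ω ∈ G.edgeFinset.powerset, rcWeight G p q B ω := rfl
  rw [Finset.sum_congr rfl hℓ, hE]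
  have hsum : ∑ ω ∈ G.edgeFinset.powerset, rcWeight G p q B ω * (((#ω : ℝ) - p * #G.edgeFinset) / (p * (1 - p))) =
      ((∑ ω ∈ G.edgeFinset.powerset, rcWeight G p q B ω * (#ω : ℝ)) -
        rcPartitionFunction G p q B * (p * #G.edgeFinset)) / (p * (1 - p)) := by
    rw [hZdef, Finset.sum_mul, ← Finset.sum_sub_distrib, Finset.sum_div]
    refine Finset.sum_congr rfl fun ω _ => ?_
    ring
  rw [hsum]
  field_simp

/-- **`d/dp log Z^B_G(p,q) = (E^B_{G,p,q}|ω| − p|E(G)|)/(p(1−p))`** — the `p`-coordinate of Grimmett's (4.72)–(4.73) for the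
finite-volume measure with the wired class `B` (`0 < p < 1`, `q > 0`). [cite: Grimmett2006, Thm. (3.73)(a); (4.72)–(4.73)] -/
theorem hasDerivAt_log_rcPartitionFunction_p {p q : ℝ} (hp : p ∈ Set.Ioo (0 : ℝ) 1) (hq : 0 < q) (B : Set V) :
    HasDerivAt (fun r => Real.log (rcPartitionFunction G r q B))
      ((rcExpect G p q B (fun ω => (#ω : ℝ)) - p * #G.edgeFinset) / (p * (1 - p))) p := by
  have hZ := (rcPartitionFunction_pos G ⟨hp.1.le, hp.2.le⟩ hq B).ne'
  have h := (hasDerivAt_rcPartitionFunction_p G hp hq B).log hZ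
  refine h.congr_deriv ?_
  rw [mul_div_cancel_left₀ _ hZ]

end Finite

/-! ### The boxes of `ℤ^d`, per site -/

section Box

variable {d : ℕ} {p q : ℝ}

/-- **`d/dp (|Λ_N|⁻¹ log Z^B_{Λ_N}(p,q)) = (|Λ_N|⁻¹E^B_{Λ_N,p,q}|ω| − p|E_{Λ_N}|/|Λ_N|)/(p(1−p))`** for every wired class `B` of
the box `Λ_N` (`0 < p < 1`, `q > 0`). [cite: Grimmett2006, (4.71)–(4.73)] -/
theorem hasDerivAt_log_rcPartitionFunction_box_div_p (hp : p ∈ Set.Ioo (0 : ℝ) 1) (hq : 0 < q) {N : ℕ}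
    (B : Set ↥(box d N)) :
    HasDerivAt (fun r => Real.log (rcPartitionFunction (finsetGraph (zdGraph d) (box d N)) r q B) / #(box d N))
      ((rcExpect (finsetGraph (zdGraph d) (box d N)) p q B (fun ω => (#ω : ℝ)) / #(box d N) -
          p * (#(finsetGraph (zdGraph d) (box d N)).edgeFinset / #(box d N))) / (p * (1 - p))) p := by
  have h := (hasDerivAt_log_rcPartitionFunction_p (finsetGraph (zdGraph d) (box d N)) hp hq B).div_const
    (#(box d N) : ℝ)
  refine h.congr_deriv ?_
  rw [div_right_comm, sub_div, mul_div_assoc]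

/-- The same as a value of `deriv`. [cite: Grimmett2006, (4.71)–(4.73)] -/
theorem deriv_log_rcPartitionFunction_box_div_p (hp : p ∈ Set.Ioo (0 : ℝ) 1) (hq : 0 < q) {N : ℕ}
    (B : Set ↥(box d N)) :
    deriv (fun r => Real.log (rcPartitionFunction (finsetGraph (zdGraph d) (box d N)) r q B) / #(box d N)) p =
      (rcExpect (finsetGraph (zdGraph d) (box d N)) p q B (fun ω => (#ω : ℝ)) / #(box d N) -
          p * (#(finsetGraph (zdGraph d) (box d N)).edgeFinset / #(box d N))) / (p * (1 - p)) :=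
  (hasDerivAt_log_rcPartitionFunction_box_div_p hp hq B).deriv

end Box

end Summit.CriticalPhenomena.PercolationContinuityZ3.Theorems.FK

end
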